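import Mathlib
import Literature.AlgebraicGeometry.Resolution.CobordantChartCoefficients

/-!
# `WeightedInvariant.LocalWeightedDrop`, line `vertex-descent-weight-residues`: grading descent

Route `ResolutionOfSingularities/WeightedInvariant`, crux `LocalWeightedDrop`
(stmt-ResolutionOfSingularities-8899), stub `stub_gradingDescent` of the lead's skeleton
`work/LocalWeightedDrop.lean`, PROVED here (statement verbatim from the ledger registration).

**Statement (GRADING DESCENT).** Let `F` be a formal power series in `x₁, …, xₙ` over a field `k`,
`w : Fin n → ℕ` weights and `c : Fin n → k` an exceptional point of the cobordant blow-up with the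
crux's convention `cᵢ = 0` whenever `wᵢ = 0`.  Substitute the cobordant chart
`chart w c : xᵢ ↦ s^{wᵢ}(cᵢ + yᵢ)` (`s = X 0`, `yᵢ = X i.succ`) and factor `F(s^w(c+y)) = sᵃ · g`.
If `D` divides every `wᵢ` with `cᵢ ≠ 0`, then every monomial `s^r y^β` of `g` satisfies
`w·β ≡ a + r (mod D)`: the torus grading of the vertex successor (`c = 0`, where `w·β = a + r`
exactly) descends to a `ℤ/D`-grading at every exceptional point.

**Proof.** By `CobordantChart.coeff_cons_of_eq_X_pow_mul` the coefficient of `s^r y^β` in `g` is the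
coefficient of `s^{a+r} y^β` in `F(s^w(c+y))`, which the COEFFICIENT FORMULA
`CobordantChart.coeff_subst_chart` writes as `∑_{d : w·d = a+r} F_d ∏ᵢ C(dᵢ, βᵢ) cᵢ^{dᵢ-βᵢ}`.  If it is
non-zero, some summand is non-zero, so there is `d` with `w·d = a + r` and all factors
`C(dᵢ, βᵢ) cᵢ^{dᵢ-βᵢ} ≠ 0`; for `cᵢ = 0` this forces `dᵢ = βᵢ` (`C(dᵢ, βᵢ) ≠ 0` gives `βᵢ ≤ dᵢ`,
`0^{dᵢ-βᵢ} ≠ 0` gives `dᵢ ≤ βᵢ`), while for `cᵢ ≠ 0` both `wᵢ dᵢ` and `wᵢ βᵢ` vanish mod `D`.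
Hence `w·β ≡ w·d = a + r (mod D)` (compared summand by summand in `ZMod D`).
-/

set_option linter.dupNamespace false -- mandated namespace of this single-conjunct summit

namespace Summit.ResolutionOfSingularities.ResolutionOfSingularities.Theorems

open Literature.AlgebraicGeometry.Resolution

/-- GRADING DESCENT (vertex ⇒ every exceptional point), stub `stub_gradingDescent` of the line
`vertex-descent-weight-residues` of crux `LocalWeightedDrop` (stmt-ResolutionOfSingularities-8899).
In the factorisation `F(s^w(c+y)) = sᵃ·g` at an exceptional point `c` (convention `cᵢ = 0` when
`wᵢ = 0`), every monomial `s^r y^β` of `g` (`e = Finsupp.cons r β`, so `r = e 0`, `β = Finsupp.tail e`)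
satisfies `w·β ≡ a + r (mod D)` for every `D` dividing all `wᵢ` with `cᵢ ≠ 0`. -/
theorem stub_gradingDescent : ∀ (k : Type) [Field k] (n : ℕ) (F : MvPowerSeries (Fin n) k) (w : Fin n → ℕ)
    (c : Fin n → k), (∀ i, w i = 0 → c i = 0) → ∀ (a : ℕ) (g : MvPowerSeries (Fin (n + 1)) k),
    MvPowerSeries.subst (CobordantChart.chart w c) F = MvPowerSeries.X 0 ^ a * g →
    ∀ D : ℕ, (∀ i, c i ≠ 0 → D ∣ w i) → ∀ e : Fin (n + 1) →₀ ℕ, MvPowerSeries.coeff e g ≠ 0 →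
    Finsupp.weight w (Finsupp.tail e) ≡ a + e 0 [MOD D] := by
  intro k _ n F w c hc a g hfac D hD e he
  -- write `e = (r, β)`
  obtain ⟨r, β, rfl⟩ : ∃ (r : ℕ) (β : Fin n →₀ ℕ), e = Finsupp.cons r β :=
    ⟨e 0, Finsupp.tail e, (Finsupp.cons_tail e).symm⟩
  simp only [Finsupp.tail_cons, Finsupp.cons_zero]
  -- the coefficient of `s^r y^β` in `g` is the coefficient formula at `s^{a+r} y^β`
  rw [CobordantChart.coeff_cons_of_eq_X_pow_mul hfac, CobordantChart.coeff_subst_chart w c hc] at he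
  -- some summand of the coefficient formula is non-zero
  obtain ⟨d, hd⟩ := not_forall.mp (mt finsum_eq_zero_of_forall_eq_zero he)
  obtain ⟨hwd, hd⟩ := ite_ne_right_iff.mp hd
  have hfac' : ∀ i, ((d i).choose (β i) : k) * c i ^ (d i - β i) ≠ 0 := fun i =>
    Finset.prod_ne_zero_iff.mp (mul_ne_zero_iff.mp hd).2 i (Finset.mem_univ i)
  -- off the support of `c` the exponent is forced: `d i = β i`
  have hdi : ∀ i, c i = 0 → d i = β i := by
    intro i hci
    have h := hfac' i
    rw [hci] at h
    by_contra hne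
    rcases Nat.lt_or_gt_of_ne hne with hlt | hgt
    · exact h (by rw [Nat.choose_eq_zero_of_lt hlt, Nat.cast_zero, zero_mul])
    · exact h (by rw [zero_pow (Nat.sub_ne_zero_of_lt hgt), mul_zero])
  -- compare `w·β` and `w·d = a + r` summand by summand in `ZMod D`
  rw [← hwd, ← ZMod.natCast_eq_natCast_iff, Finsupp.weight_apply, Finsupp.weight_apply,
    Finsupp.sum_fintype _ _ (fun _ => by simp), Finsupp.sum_fintype _ _ (fun _ => by simp),
    Nat.cast_sum, Nat.cast_sum]
  refine Finset.sum_congr rfl fun i _ => ?_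
  by_cases hci : c i = 0
  · rw [hdi i hci]
  · obtain ⟨m, hm⟩ := hD i hci
    simp [hm]

end Summit.ResolutionOfSingularities.ResolutionOfSingularities.Theorems
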